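import Literature.AlgebraicGeometry.HodgeTheory.HypersurfaceResidueFormNonzero
import Literature.Geometry.Kaehler.HolomorphicTopFormsLine

/-!
# Growth of the ratio of a holomorphic top form to the residue form `Res(x_{i₀}^k Ω/F)` along the affine chart (programme PG-FERMAT, brick F1c)

Prover seat `hodge-nonav-prover-Bx` (g10), cell `hodge-nonav`, for crux K1-A (stmt-HodgeConjecture-19544). Setting of
`HypersurfaceResidueFormDef` / `HypersurfaceResidueFormNonzero`: `F ∈ ℂ[X₀, …, X_{m+1}]` homogeneous of degree `d ≥ m + 2` with
non-vanishing gradient on its cone, `M` a COMPACT complex manifold charted on `E` (`dim_ℂ E = m`), `ψ : M → ℙ(ℂ^{m+2})` a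
topological embedding into `V(F)` with holomorphic affine coordinates; `k = d - (m + 2)`, `η_i = ψ^* Res(X_i^k Ω/F)`
(`residueForm ψ F (X i ^ k)`, holomorphic in charts, non-zero on `M_i = ψ⁻¹(U_i)` by `residueForm_ne_zero`). For a form `η`
holomorphic in charts, the ratio `f_{i₀} = η(b)/η_{i₀}(b)` (`b` a complex basis of `E`; `η = f_{i₀} η_{i₀}` on `M_{i₀}`) is the
function programme PG-FERMAT reads in the affine coordinates `u_{i₀} = (x_j/x_{i₀})_{j ≠ i₀}` and feeds to brick F3
(`CyclicUnitaryPowersFermatAffineEigenfunctions.eqOn_zero_of_eigenfunction_of_growth`), whose hypothesis `hgr` is the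
polynomial growth proved here:

* `residueForm_X_pow_eq_smul` — **change of numerator**: on `M_i`, `η_{i₀} = (x_{i₀}/x_i)^k • η_i`
  (both are `P(Z̃) · det(N, Z̃, dZ̃ ·)` with the same lift `Z̃`, and `Z̃_{i₀} = (x_{i₀}/x_i) Z̃_i` coordinatewise);
* `exists_liftDomain_norm_affineCoord_le_one`, `isClosed_normBall` — the compact sets `K_i = {|x_j| ≤ |x_i| ∀ j} ⊆ M_i` cover `M`;
* `exists_bound_topFormRatio` — **`|f_{i₀}(x)| ≤ C · (1 + ‖u_{i₀}(x)‖)^k` on `M_{i₀}`**: on `K_i` the continuous ratio `f_i` is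
  bounded (`IsCompact.exists_bound_of_continuousOn`), and `f_{i₀} = (x_i/x_{i₀})^k f_i` with `|x_i/x_{i₀}| ≤ 1 + ‖u_{i₀}(x)‖`.

Sorry-free; no definition, no named fact; helper (`--supports stmt-HodgeConjecture-19544`); nothing here says HC ∕ HC_AV is proved.
(Griffiths, *On the periods of certain rational integrals* I, Ann. of Math. 90 (1969), §8: the holomorphic forms of a smooth
hypersurface of degree `d` are the `Res(PΩ/F)`, `deg P = d - m - 2` — of which this growth bound is the analytic shadow.)
-/

noncomputable section

set_option linter.dupNamespace false

open scoped Manifold ContDiff Topology LinearAlgebra.Projectivization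
open Set Filter Function Projectivization

namespace Summit.HodgeConjecture.HodgeConjecture.Theorems.CyclicUnitaryPowersTopFormRatioGrowth

open Literature.AlgebraicGeometry.HodgeTheory Literature.NumberTheory.Transcendental Literature.Geometry.Kaehler

variable {m : ℕ} {E : Type*} [NormedAddCommGroup E] [NormedSpace ℂ E] [FiniteDimensional ℂ E]
  {M : Type*} [TopologicalSpace M] [ChartedSpace E M] [IsManifold 𝓘(ℂ, E) ω M] [IsManifold 𝓘(ℝ, E) ∞ M]
  (ψ : M → ℙ ℂ (Fin (m + 2) → ℂ)) {F : MvPolynomial (Fin (m + 2)) ℂ} {d : ℕ}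

/-! ### Coordinates of the lifts -/

omit [FiniteDimensional ℂ E] [IsManifold 𝓘(ℂ, E) ω M] [IsManifold 𝓘(ℝ, E) ∞ M] [ChartedSpace E M]
  [TopologicalSpace M] [NormedAddCommGroup E] [NormedSpace ℂ E] in
/-- On `M_j`, the `i`-th coordinate of the lift `Z̃_j(x)` is non-zero iff `x ∈ M_i` (both say `x_i ≠ 0`). [folklore] -/
theorem projLift_apply_ne_zero_iff {j i : Fin (m + 2)} {x : M} (hj : x ∈ liftDomain ψ j) :
    projLift ψ j x i ≠ 0 ↔ x ∈ liftDomain ψ i := by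
  rw [mem_liftDomain_iff, stdChart_source, ← mk_projLift ψ hj, mk_mem_stdChartSource_iff]

omit [FiniteDimensional ℂ E] [IsManifold 𝓘(ℂ, E) ω M] [IsManifold 𝓘(ℝ, E) ∞ M] [ChartedSpace E M]
  [TopologicalSpace M] [NormedAddCommGroup E] [NormedSpace ℂ E] in
/-- **Change of lift, coordinatewise**: on `M_j ∩ M_i`, `(Z̃_j x)_i · (Z̃_i x)_l = (Z̃_j x)_l`. [folklore] -/
theorem projLift_apply_mul {j i : Fin (m + 2)} {x : M} (hj : x ∈ liftDomain ψ j) (hi : x ∈ liftDomain ψ i)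
    (l : Fin (m + 2)) : projLift ψ j x i * projLift ψ i x l = projLift ψ j x l := by
  have hne : projLift ψ j x i ≠ 0 := (projLift_apply_ne_zero_iff ψ hj).2 hi
  have h := congrFun (projLift_eq_smul_of_mem ψ hj hi) l
  rw [Pi.smul_apply, smul_eq_mul] at h
  rw [h, ← mul_assoc, mul_inv_cancel₀ hne, one_mul]

omit [FiniteDimensional ℂ E] [IsManifold 𝓘(ℂ, E) ω M] [IsManifold 𝓘(ℝ, E) ∞ M] [ChartedSpace E M]
  [TopologicalSpace M] [NormedAddCommGroup E] [NormedSpace ℂ E] in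
/-- The affine coordinates are the off-slot coordinates of the lift: `u_i(x)_l = (Z̃_i x)_{i.succAbove l}`. [folklore] -/
theorem projLift_apply_succAbove (i : Fin (m + 2)) (x : M) (l : Fin (m + 1)) :
    projLift ψ i x (i.succAbove l) = affineCoord ψ i x l := by
  simp [projLift]

omit [FiniteDimensional ℂ E] [IsManifold 𝓘(ℂ, E) ω M] [IsManifold 𝓘(ℝ, E) ∞ M] [ChartedSpace E M]
  [TopologicalSpace M] [NormedAddCommGroup E] [NormedSpace ℂ E] in
/-- `|(Z̃_{i₀} x)_i| ≤ 1 + ‖u_{i₀}(x)‖` for every `i` (it is `1` at `i = i₀` and an affine coordinate otherwise). [folklore] -/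
theorem norm_projLift_apply_le (i₀ i : Fin (m + 2)) (x : M) :
    ‖projLift ψ i₀ x i‖ ≤ 1 + ‖affineCoord ψ i₀ x‖ := by
  rcases Fin.eq_self_or_eq_succAbove i₀ i with rfl | ⟨l, rfl⟩
  · rw [projLift_apply_self, norm_one]
    exact le_add_of_nonneg_right (norm_nonneg _)
  · rw [projLift_apply_succAbove]
    exact (norm_le_pi_norm _ l).trans (le_add_of_nonneg_left zero_le_one)

/-! ### Change of numerator for the residue forms `Res(X_i^k Ω/F)` -/

omit [FiniteDimensional ℂ E] [IsManifold 𝓘(ℂ, E) ω M] [IsManifold 𝓘(ℝ, E) ∞ M] in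
/-- **Change of numerator**: on `M_i`, `ψ^* Res(X_{i₀}^k Ω/F) = (x_{i₀}/x_i)^k • ψ^* Res(X_i^k Ω/F)` pointwise, with
`x_{i₀}/x_i = (Z̃_i x)_{i₀}`: both sides are `P(Z̃) · det(N(Z̃), Z̃, dZ̃ ·)` for the SAME chosen lift `Z̃ = Z̃_j(x)` and normal index
(`residueForm`, `residueFormula`), and `(Z̃_j x)_{i₀} = (Z̃_j x)_i (Z̃_i x)_{i₀}` (`projLift_apply_mul`).
[cite: VoisinHodgeII2003, §6.1.1 and §6.1.3] -/
theorem residueForm_X_pow_eq_smul (k : ℕ) {i₀ i : Fin (m + 2)} {x : M} (hi : x ∈ liftDomain ψ i) :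
    (residueForm (E := E) ψ F (MvPolynomial.X i₀ ^ k) x : E [⋀^Fin m]→L[ℝ] ℂ) =
      (projLift ψ i x i₀) ^ k • (residueForm (E := E) ψ F (MvPolynomial.X i ^ k) x : E [⋀^Fin m]→L[ℝ] ℂ) := by
  set j := residueIdx ψ x with hjdef
  have hj : x ∈ liftDomain ψ j := residueIdx_spec ψ x
  have hmul : projLift ψ j x i₀ = projLift ψ j x i * projLift ψ i x i₀ := (projLift_apply_mul ψ hj hi i₀).symm
  have key : residueFormula (E := E) ψ F (MvPolynomial.X i₀ ^ k) j (residueJdx F (projLift ψ j x)) x =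
      (projLift ψ i x i₀) ^ k • residueFormula (E := E) ψ F (MvPolynomial.X i ^ k) j (residueJdx F (projLift ψ j x)) x := by
    rw [residueFormula, residueFormula, map_pow, map_pow, MvPolynomial.eval_X, MvPolynomial.eval_X, hmul, mul_pow,
      smul_smul, mul_comm]
  show ((residueFormula (E := E) ψ F (MvPolynomial.X i₀ ^ k) j (residueJdx F (projLift ψ j x)) x).restrictScalars ℝ :
      E [⋀^Fin m]→L[ℝ] ℂ) =
    (projLift ψ i x i₀) ^ k •
      ((residueFormula (E := E) ψ F (MvPolynomial.X i ^ k) j (residueJdx F (projLift ψ j x)) x).restrictScalars ℝ :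
        E [⋀^Fin m]→L[ℝ] ℂ)
  rw [key]
  ext v
  rfl

/-! ### The compact pieces `K_i = {|x_j| ≤ |x_i|}` -/

omit [FiniteDimensional ℂ E] [IsManifold 𝓘(ℂ, E) ω M] [IsManifold 𝓘(ℝ, E) ∞ M] [ChartedSpace E M]
  [TopologicalSpace M] [NormedAddCommGroup E] [NormedSpace ℂ E] in
/-- **The `K_i` cover `M`**: every point lies in some `M_i` with all affine coordinates of modulus `≤ 1` (take `i` maximising
`|x_i|` among the homogeneous coordinates). [folklore] -/
theorem exists_liftDomain_norm_affineCoord_le_one (x : M) :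
    ∃ i, x ∈ liftDomain ψ i ∧ ∀ l, ‖affineCoord ψ i x l‖ ≤ 1 := by
  set j := residueIdx ψ x with hjdef
  have hj : x ∈ liftDomain ψ j := residueIdx_spec ψ x
  obtain ⟨i, -, hi⟩ := Finset.exists_max_image Finset.univ (fun l ↦ ‖projLift ψ j x l‖) Finset.univ_nonempty
  have hi1 : 1 ≤ ‖projLift ψ j x i‖ := by
    have := hi j (Finset.mem_univ _)
    rwa [projLift_apply_self, norm_one] at this
  have hne : projLift ψ j x i ≠ 0 := fun h ↦ by rw [h, norm_zero] at hi1; exact absurd hi1 (by norm_num)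
  have hxi : x ∈ liftDomain ψ i := (projLift_apply_ne_zero_iff ψ hj).1 hne
  refine ⟨i, hxi, fun l ↦ ?_⟩
  rw [← projLift_apply_succAbove]
  have hm := projLift_apply_mul ψ hj hxi (i.succAbove l)
  have hpos : 0 < ‖projLift ψ j x i‖ := lt_of_lt_of_le zero_lt_one hi1
  have key : ‖projLift ψ j x i‖ * ‖projLift ψ i x (i.succAbove l)‖ ≤ ‖projLift ψ j x i‖ * 1 := by
    rw [← norm_mul, hm, mul_one]; exact hi _ (Finset.mem_univ _)
  exact le_of_mul_le_mul_left key hpos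

omit [FiniteDimensional ℂ E] [IsManifold 𝓘(ℂ, E) ω M] [IsManifold 𝓘(ℝ, E) ∞ M] in
/-- **`K_i = {x ∈ M_i | ‖u_i(x)_l‖ ≤ 1 ∀ l}` is closed**: its complement is the union over `l` of the open sets
`{x ∈ M_l | |(Z̃_l x)_i| < 1}` (`|x_i| < |x_l|`), open because the lifts are continuous on their chart domains. [folklore] -/
theorem isClosed_normBall (hψ : Continuous ψ) (hhol : HasHolomorphicCoords E ψ) (i : Fin (m + 2)) :
    IsClosed {x : M | x ∈ liftDomain ψ i ∧ ∀ l, ‖affineCoord ψ i x l‖ ≤ 1} := by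
  rw [← isOpen_compl_iff]
  have hset : {x : M | x ∈ liftDomain ψ i ∧ ∀ l, ‖affineCoord ψ i x l‖ ≤ 1}ᶜ =
      ⋃ l, liftDomain ψ l ∩ (fun x ↦ ‖projLift ψ l x i‖) ⁻¹' Iio 1 := by
    ext x
    simp only [mem_compl_iff, mem_setOf_eq, not_and, not_forall, not_le, mem_iUnion, mem_inter_iff, mem_preimage,
      mem_Iio]
    constructor
    · intro h
      by_cases hxi : x ∈ liftDomain ψ i
      · obtain ⟨l, hl⟩ := h hxi
        have hne : projLift ψ i x (i.succAbove l) ≠ 0 := by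
          rw [projLift_apply_succAbove]; intro h0; rw [h0, norm_zero] at hl; exact absurd hl (by norm_num)
        have hxl : x ∈ liftDomain ψ (i.succAbove l) := (projLift_apply_ne_zero_iff ψ hxi).1 hne
        refine ⟨i.succAbove l, hxl, ?_⟩
        have hm := projLift_apply_mul ψ hxi hxl i
        rw [projLift_apply_self] at hm
        have hnorm : ‖projLift ψ i x (i.succAbove l)‖ * ‖projLift ψ (i.succAbove l) x i‖ = 1 := by
          rw [← norm_mul, hm, norm_one]
        rw [projLift_apply_succAbove] at hnorm
        by_contra hge
        push Not at hge
        have : 1 < ‖affineCoord ψ i x l‖ * ‖projLift ψ (i.succAbove l) x i‖ :=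
          lt_of_lt_of_le (by simpa using hl) (le_mul_of_one_le_right (norm_nonneg _) hge)
        rw [hnorm] at this
        exact lt_irrefl _ this
      · set j := residueIdx ψ x
        have hj : x ∈ liftDomain ψ j := residueIdx_spec ψ x
        have h0 : projLift ψ j x i = 0 := by
          by_contra hne
          exact hxi ((projLift_apply_ne_zero_iff ψ hj).1 hne)
        exact ⟨j, hj, by rw [h0, norm_zero]; exact zero_lt_one⟩
    · rintro ⟨l, hxl, hlt⟩ hxi
      have hm := projLift_apply_mul ψ hxl hxi l
      rw [projLift_apply_self] at hm
      rcases Fin.eq_self_or_eq_succAbove i l with rfl | ⟨l', rfl⟩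
      · rw [projLift_apply_self, norm_one] at hlt
        exact absurd hlt (lt_irrefl _)
      · refine ⟨l', ?_⟩
        rw [← projLift_apply_succAbove]
        by_contra hle
        push Not at hle
        have : ‖projLift ψ (i.succAbove l') x i‖ * ‖projLift ψ i x (i.succAbove l')‖ < 1 := by
          calc ‖projLift ψ (i.succAbove l') x i‖ * ‖projLift ψ i x (i.succAbove l')‖
              ≤ ‖projLift ψ (i.succAbove l') x i‖ * 1 := by gcongr
            _ < 1 := by rw [mul_one]; exact hlt
        rw [← norm_mul, hm, norm_one] at this
        exact lt_irrefl _ this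
  rw [hset]
  refine isOpen_iUnion fun l ↦ ?_
  have hcont : ContinuousOn (fun x ↦ ‖projLift ψ l x i‖) (liftDomain ψ l) :=
    ((continuous_apply i).comp_continuousOn (mdifferentiableOn_projLift ψ hhol l).continuousOn).norm
  exact hcont.isOpen_inter_preimage (isOpen_liftDomain ψ hψ l) isOpen_Iio

/-! ### The growth bound -/

/-- **Polynomial growth of the top-form ratio along the affine chart.** Let `F` be homogeneous of degree `d ≥ m + 2` with
non-vanishing gradient at its non-zero zeros, `M` compact, `ψ : M → ℙ(ℂ^{m+2})` a topological embedding into `V(F)` with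
holomorphic affine coordinates, `dim_ℂ E = m`, `b` a complex basis of `E`, `k = d - (m + 2)`. For an `m`-form `η` holomorphic
in charts, the ratio `f_{i₀}(x) = η_x(b) / (ψ^* Res(X_{i₀}^k Ω/F))_x(b)` satisfies `|f_{i₀}(x)| ≤ C (1 + ‖u_{i₀}(x)‖)^k` on
`M_{i₀}`. Proof: `M = ⋃ K_i` with `K_i = {|x_j| ≤ |x_i|} ⊆ M_i` compact; on `K_i` the ratio `f_i` (continuous on `M_i`:
`mdifferentiableAt_topFormRatio_of_isHolomorphicInCharts`, the denominator vanishing nowhere on `M_i` by `residueForm_ne_zero`)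
is bounded by `C_i`, and `f_{i₀} = (Z̃_{i₀} x)_i^k · f_i` there (`residueForm_X_pow_eq_smul`), `|(Z̃_{i₀} x)_i| ≤ 1 + ‖u_{i₀}(x)‖`.
[cite: VoisinHodgeII2003, §6.1.3, Thm. 6.10 and Cor. 6.12 (p = 1)] -/
theorem exists_bound_topFormRatio [CompactSpace M] (hF : F.IsHomogeneous d) (hψ : Topology.IsEmbedding ψ)
    (hrange : Set.range ψ ⊆ projZeroLocus {F})
    (hjac : ∀ z : Fin (m + 2) → ℂ, z ≠ 0 → MvPolynomial.eval z F = 0 →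
      ∃ j, MvPolynomial.eval z (MvPolynomial.pderiv j F) ≠ 0)
    (hhol : HasHolomorphicCoords E ψ) (hdim : Module.finrank ℂ E = m) (hd : m + 2 ≤ d)
    {η : MForm 𝓘(ℝ, E) M ℂ m} (hη : IsHolomorphicInCharts η) (b : Module.Basis (Fin m) ℂ E) (i₀ : Fin (m + 2)) :
    ∃ C : ℝ, ∀ x ∈ liftDomain ψ i₀,
      ‖(η x : E [⋀^Fin m]→L[ℝ] ℂ) b /
          (residueForm (E := E) ψ F (MvPolynomial.X i₀ ^ (d - (m + 2))) x : E [⋀^Fin m]→L[ℝ] ℂ) b‖ ≤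
        C * (1 + ‖affineCoord ψ i₀ x‖) ^ (d - (m + 2)) := by
  have hψc : Continuous ψ := hψ.continuous
  set k := d - (m + 2) with hk
  -- the residue forms `η_i`
  set ρ : Fin (m + 2) → MForm 𝓘(ℝ, E) M ℂ m := fun i ↦ residueForm (E := E) ψ F (MvPolynomial.X i ^ k) with hρ
  have hρhol : ∀ i, IsHolomorphicInCharts (ρ i) := fun i ↦
    isHolomorphicInCharts_residueForm ψ hF hψc hrange hjac hhol
      (by simpa using (MvPolynomial.isHomogeneous_X ℂ i).pow k) hd
  have hρne : ∀ i, ∀ x ∈ liftDomain ψ i, (ρ i x : E [⋀^Fin m]→L[ℝ] ℂ) b ≠ 0 := fun i x hx ↦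
    (hρhol i).apply_basis_ne_zero b (residueForm_ne_zero ψ hF hψ hrange hjac hhol hdim hd hx)
  -- the ratios `f_i`, continuous on `M_i`
  set f : Fin (m + 2) → M → ℂ := fun i x ↦ (η x : E [⋀^Fin m]→L[ℝ] ℂ) b / (ρ i x : E [⋀^Fin m]→L[ℝ] ℂ) b with hf
  have hfcont : ∀ i, ContinuousOn (f i) (liftDomain ψ i) := by
    intro i x hx
    have hne : ∀ᶠ y in 𝓝 x, (ρ i y : E [⋀^Fin m]→L[ℝ] ℂ) b ≠ 0 := by
      filter_upwards [(isOpen_liftDomain ψ hψc i).mem_nhds hx] with y hy using hρne i y hy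
    exact (mdifferentiableAt_topFormRatio_of_isHolomorphicInCharts hdim hη (hρhol i) b.linearIndependent
      hne).continuousAt.continuousWithinAt
  -- bounds on the compact pieces `K_i`
  have hbound : ∀ i, ∃ C, 0 ≤ C ∧ ∀ x ∈ liftDomain ψ i, (∀ l, ‖affineCoord ψ i x l‖ ≤ 1) → ‖f i x‖ ≤ C := by
    intro i
    have hK : IsCompact {x : M | x ∈ liftDomain ψ i ∧ ∀ l, ‖affineCoord ψ i x l‖ ≤ 1} :=
      (isClosed_normBall ψ hψc hhol i).isCompact
    obtain ⟨C, hC⟩ := hK.exists_bound_of_continuousOn ((hfcont i).mono fun x hx ↦ hx.1)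
    exact ⟨max C 0, le_max_right _ _, fun x hx hxl ↦ (hC x ⟨hx, hxl⟩).trans (le_max_left _ _)⟩
  choose C hC0 hC using hbound
  refine ⟨∑ i, C i, fun x hx ↦ ?_⟩
  -- `x ∈ K_i` for some `i`
  obtain ⟨i, hxi, hxl⟩ := exists_liftDomain_norm_affineCoord_le_one ψ x
  have hratio : f i₀ x = (projLift ψ i₀ x i) ^ k * f i x := by
    have h1 : (ρ i₀ x : E [⋀^Fin m]→L[ℝ] ℂ) b = (projLift ψ i x i₀) ^ k * (ρ i x : E [⋀^Fin m]→L[ℝ] ℂ) b := by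
      have := residueForm_X_pow_eq_smul (E := E) ψ (F := F) k (i₀ := i₀) hxi
      simp only [hρ]
      rw [this]
      rfl
    have hinv : projLift ψ i x i₀ * projLift ψ i₀ x i = 1 := by
      rw [projLift_apply_mul ψ hxi hx i, projLift_apply_self]
    have hne0 : projLift ψ i x i₀ ≠ 0 := left_ne_zero_of_mul_eq_one hinv
    have hinv' : projLift ψ i₀ x i = (projLift ψ i x i₀)⁻¹ := eq_inv_of_mul_eq_one_right hinv
    simp only [hf, h1]
    rw [hinv', inv_pow]
    field_simp
  show ‖f i₀ x‖ ≤ (∑ j, C j) * (1 + ‖affineCoord ψ i₀ x‖) ^ k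
  rw [hratio, norm_mul, norm_pow]
  have h1 : ‖projLift ψ i₀ x i‖ ^ k ≤ (1 + ‖affineCoord ψ i₀ x‖) ^ k :=
    pow_le_pow_left₀ (norm_nonneg _) (norm_projLift_apply_le ψ i₀ i x) k
  have h2 : ‖f i x‖ ≤ C i := hC i x hxi hxl
  have h3 : C i ≤ ∑ j, C j := Finset.single_le_sum (fun j _ ↦ hC0 j) (Finset.mem_univ i)
  calc ‖projLift ψ i₀ x i‖ ^ k * ‖f i x‖ ≤ (1 + ‖affineCoord ψ i₀ x‖) ^ k * C i :=
        mul_le_mul h1 h2 (norm_nonneg _) (pow_nonneg (by positivity) _)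
    _ ≤ (1 + ‖affineCoord ψ i₀ x‖) ^ k * ∑ j, C j :=
        mul_le_mul_of_nonneg_left h3 (pow_nonneg (by positivity) _)
    _ = (∑ j, C j) * (1 + ‖affineCoord ψ i₀ x‖) ^ k := mul_comm _ _

end Summit.HodgeConjecture.HodgeConjecture.Theorems.CyclicUnitaryPowersTopFormRatioGrowth

end
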